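import Literature.Analysis.FunctionSpaces.TorusTrigPoly
import Summits.QuantumFields.BalabanUV.Gaps.D1CoDressedLongitudinalForm
import Summits.QuantumFields.BalabanUV.Gaps.D1WardPSDSandwich

/-!
# `BalabanUV.Gaps.D1SymbolPSDCertificate` — cell pub-balaban-gaps, row (D1), seat g1-p1: BOCHNER FOR MATRIX KERNELS ON `ℤ^d`, BOTH DIRECTIONS — `ConvPSD P` (the PSD binder of the
# β sub-cell's Lemma 5.2 and of rows 86 ∕ 87 ∕ 92 ∕ 93) IS EQUIVALENT, for absolutely summable `P`, to «the symbol `P̂(t) = Σ_z P(z) e_{−z}(t)` has a quadratic form with nonnegative real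
# part at every point `t` of the dual torus `(ℝ∕ℤ)^d`»; the certificate direction in real coordinates `k ∈ [0,1)^d` is the KERNEL-SIDE SOCKET a certified (interval) symbol computation
# plugs into, and at the row-(D1) literals it turns «hW_j + certificate» (at an2's chart-(II) literal: the certificate ALONE) into `0 ≤ β⁰_j(μ,ν)`

HONEST FRAMING (cell rule, page 1 of everything): [folklore] lattice Fourier analysis — orthogonality of the characters of `(ℝ∕ℤ)^d` for the tree's global `volume`
(`Literature.Analysis.FunctionSpaces.Torus.integral_mFourier`), term-by-term integration of an absolutely convergent character series (Mathlib's `integral_tsum_of_summable_integral_norm`,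
`continuous_tsum`), and, for the converse, the β sub-cell's own Følner-ratio argument (`PolarizationSign.sum_sum_sub_eq_tsum`, `tendsto_overlap_div_card`) run with a complex vector plane
wave instead of `cos(p x_α) e_β`.  Composition BY NAME with row 86 (`D1WardLongitudinalForm`), row 87 (`D1CoDressedLongitudinalForm`), row 92 (`D1WardPSDSandwich`) and GEN 14's
`momentSummable_TbalOf`.  NOTHING of Bałaban's is asserted: `ConvPSD` is NOT printed for Bałaban's Π ([Balaban1987RG1] p. 293 prints (5.7)–(5.10); PSD is hypothesis (ii) of the β sub-cell's
programme-internal Lemma 5.2, `LogDetVariation` signs PIECES only); this file proves an EQUIVALENCE between two predicates on an abstract kernel and DISCHARGES NOTHING — no symbol of any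
literal is computed or certified here (a float64 screen of ONE transcription at level 0, `g1/D1-SYMMETRY-BINDERS-BYVALUE-g1p1.md` RESULT-6, has zero classification weight); the Ward binder
`hW_j` at the pinned ∕ (III′) literals REMAINS a hypothesis; NO coefficient of Bałaban's computed or signed; (D1) NOT discharged; 0∕4 row-D1 binders at the pinned ∕ (III′) literals; NOT `BetaPertH`,
NOT continuum, NOT Clay.
HONEST DEPENDENCY (b2b cell, verbatim): «continuum YM on T⁴ ⇐ BetaPertH ∧ nine spine estimates (0/9 proved); BetaPertH ⇐ (D1) ∧ (D4) ∧ CAP+tail; G-an2-4 gates asym, D1 and NE2/3/4.»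

WHY (census row 94 of `HOME/g1/RESIDUE.md`).  Rows 86 ∕ 87 ∕ 92 ∕ 93 reduced the SIGN half of the (1.22) coefficient at every row-(D1) literal to ONE undischarged hypothesis per level,
`ConvPSD (flipK T_j)` — positive semi-definiteness of the convolution form on ALL finitely supported real test functions, a statement no finite computation checks directly.  The β
sub-cell's `PolarizationSign` has only the NECESSITY direction, and only for diagonal entries against axis plane waves (`bochner_diag_cos`).  This file supplies (i) the SUFFICIENCY
direction in the form a certificate engine can target — finitely many entries `Σ_z T_j(μ,ν,z) e^{−2πi k·z}` of a `d × d` matrix symbol, to be enclosed PSD (real part of the quadratic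
form `≥ 0`) uniformly over the compact cube `k ∈ [0,1]^d` — and (ii) the full necessity direction, so that a certified NEGATIVE value at one `(k, v)` REFUTES `ConvPSD (flipK T_j)`.
Consequences recorded: `ConvPSD` is blind to the flip `z ↦ −z` of the difference variable (through the symbol at `−t`; not a formal triviality for a non-symmetric kernel), so the
certificate may be computed on the UNFLIPPED table `T_j` as deposited; at an2's chart-(II) literal `JsRowD1Pin hLc N` (hW ∧ hR theorems) a level-`j` certificate ALONE gives `0 ≤ β⁰_j(μ,ν)`;
at the pinned ∕ (III′) literals `hW_j` + certificate give row 92's sandwich `0 ≤ β⁰_j(μ,ν) ≤ −¼ Σ_z tr T_j(z)|z|²`.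
WHAT IT IS NOT: no certificate is produced; `hW_j` (pinned ∕ (III′)), the VALUE side of (D1), (1.21), `D1Tel` ∕ `D1Rep` untouched; the words of the row do not move.

CONTENT (all [folklore]; no `def`, no `def … : Prop`, 0 sorry; the symbol is written out in Mathlib's vocabulary `UnitAddTorus.mFourier`, no new notion is introduced):
§1 pointwise character facts (`norm_mFourier_apply`, `mFourier_mul_mFourier_neg_mul`, `conj_mFourier_neg`); §2 `continuous_tsum_mul_mFourier` (symbol entries are continuous),
**`integral_mFourier_mul_symbol`** (`∫ e_x e_{−y} P̂_{μν} = P_{μν}(x − y)`); §3 **`convPSD_of_symbol_re_nonneg`** (THE CERTIFICATE: pointwise `0 ≤ Re v* P̂(t) v` on `(ℝ∕ℤ)^d` ⟹ `ConvPSD P`);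
§4 `convForm_re_add_convForm_im`, **`symbol_re_nonneg_of_convPSD`** (necessity), **`convPSD_iff_symbol_re_nonneg`**; §5 `mFourier_apply_neg`, `symbol_flipK`, `symbol_re_nonneg_flipK_iff`,
`summable_abs_flipK_iff`, **`convPSD_flipK_iff`**, `mFourier_neg_coe_apply` (`e_{−z}(k mod ℤ^d) = e^{−2πi k·z}`), `exists_Ico_coe_eq`, **`convPSD_of_symbol_re_nonneg_Ico`** (real coordinates,
`k ∈ [0,1)^d`), `convPSD_flipK_of_symbol_re_nonneg_Ico`; §6 at the literals (`d = 4`): `secondMoment_nonneg_of_ward_indexSymmetric_symbol` (generic Lemma 5.2 with the certificate),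
`summable_abs_TbalOf`, **`convPSD_flipK_TbalOf_of_symbol_re_nonneg_Ico`** (the socket, any one-step family), **`symbol_re_nonneg_of_convPSD_flipK_TbalOf`** (its necessity, all real `k`),
**`secondMoment_TbalOf_JsRowD1Pin_nonneg_of_symbol`** (chart-(II): certificate alone ⟹ `0 ≤ β⁰_j`), `secondMoment_TbalOf_JsBalAn1_nonneg_of_hW_symbol`,
`secondMoment_TbalOf_JsBalAn1_sandwich_of_hW_symbol`, `secondMoment_TbalOf_JsB12CombShSym_sandwich_of_hW_symbol`.

Provenance: cell pub-balaban-gaps, seat g1-p1 GEN 19 (prover-pub-balaban-gaps-g1-p1-g19-0), 2026-08-25 (INTENT-71, announced by GEN 18); imports this seat's rows 87 ∕ 92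
(`Gaps/D1CoDressedLongitudinalForm` p402229 ✓, `Gaps/D1WardPSDSandwich` p403385 ✓; through them row 86 and GEN 14's `D1IndexSymmetryDictionary`) and the function-space layer's
`Literature/Analysis/FunctionSpaces/TorusTrigPoly` (orthonormality of `mFourier` for the global `volume`, `Continuous.integrable_unitAddTorus`); no existing file touched.
-/

noncomputable section

open MeasureTheory Complex Finset Filter Topology
open scoped ComplexConjugate BigOperators Real

namespace Summit.QuantumFields.BalabanUV.Gaps.D1SymbolPSDCertificate

open Literature.MathematicalPhysics.QuantumFieldTheory.Balaban1983to89
open Literature.MathematicalPhysics.QuantumFieldTheory.Balaban1983to89.Beta.PolarizationSign (ConvPSD)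
open UnitAddTorus (mFourier mFourier_neg mFourier_add mFourier_zero)
open Literature.Analysis.FunctionSpaces (Torus.integral_mFourier)

variable {d : ℕ}

/-! ## §1 The characters `e_n(t) = mFourier n t` of the dual torus `(ℝ∕ℤ)^d`: pointwise facts -/

/-- [folklore] `|e_n(t)| = 1` pointwise. -/
theorem norm_mFourier_apply (n : Fin d → ℤ) (t : UnitAddTorus (Fin d)) : ‖mFourier n t‖ = 1 := by
  simp only [mFourier, fourier_apply, ContinuousMap.coe_mk, norm_prod, Circle.norm_coe, Finset.prod_const_one]

/-- [folklore] `e_m(t) e_{-n}(t) e_{-z}(t) = e_{m - n - z}(t)`. -/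
theorem mFourier_mul_mFourier_neg_mul (m n z : Fin d → ℤ) (t : UnitAddTorus (Fin d)) :
    mFourier m t * mFourier (-n) t * mFourier (-z) t = mFourier (m - n - z) t := by
  rw [sub_eq_add_neg, sub_eq_add_neg, mFourier_add, mFourier_add]

/-- [folklore] `conj e_{-n}(t) = e_n(t)`. -/
theorem conj_mFourier_neg (n : Fin d → ℤ) (t : UnitAddTorus (Fin d)) : conj (mFourier (-n) t) = mFourier n t := by
  rw [mFourier_neg, conj_conj]

/-! ## §2 The symbol (matrix Fourier series) of an absolutely summable kernel: continuity and the orthogonality integral -/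

/-- [folklore] Each entry of the symbol `t ↦ Σ_z P_{μν}(z) e_{-z}(t)` (and its shifts `e_{w - z}`) is a uniformly convergent series of characters,
hence continuous on the dual torus. -/
theorem continuous_tsum_mul_mFourier {P : B12Beta.Kernel d} (hS : ∀ μ ν, Summable fun z => |P μ ν z|) (μ ν : Fin d)
    (w : (Fin d → ℤ) → (Fin d → ℤ)) : Continuous fun t : UnitAddTorus (Fin d) => ∑' z, (P μ ν z : ℂ) * mFourier (w z) t := by
  refine continuous_tsum (fun z => continuous_const.mul (mFourier (w z)).continuous) (hS μ ν) fun z t => ?_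
  rw [norm_mul, norm_mFourier_apply, mul_one, Complex.norm_real, Real.norm_eq_abs]

/-- [folklore] THE ORTHOGONALITY INTEGRAL: `∫_{(ℝ∕ℤ)^d} e_x(t) e_{-y}(t) (Σ_z P_{μν}(z) e_{-z}(t)) dt = P_{μν}(x - y)` — term-by-term integration of the
absolutely convergent series against `∫ e_n = [n = 0]` (`Torus.integral_mFourier`). -/
theorem integral_mFourier_mul_symbol {P : B12Beta.Kernel d} (hS : ∀ μ ν, Summable fun z => |P μ ν z|) (μ ν : Fin d) (x y : Fin d → ℤ) :
    ∫ t : UnitAddTorus (Fin d), mFourier x t * mFourier (-y) t * ∑' z, (P μ ν z : ℂ) * mFourier (-z) t = (P μ ν (x - y) : ℂ) := by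
  have hpt : ∀ t : UnitAddTorus (Fin d), mFourier x t * mFourier (-y) t * ∑' z, (P μ ν z : ℂ) * mFourier (-z) t
      = ∑' z, (P μ ν z : ℂ) * mFourier (x - y - z) t := fun t => by
    rw [← tsum_mul_left]; exact tsum_congr fun z => by rw [← mFourier_mul_mFourier_neg_mul]; ring
  simp_rw [hpt]
  have hint : ∀ z, Integrable (fun t : UnitAddTorus (Fin d) => (P μ ν z : ℂ) * mFourier (x - y - z) t) :=
    fun z => (continuous_const.mul (mFourier (x - y - z)).continuous).integrable_unitAddTorus
  have hnorm : ∀ z, ∫ t : UnitAddTorus (Fin d), ‖(P μ ν z : ℂ) * mFourier (x - y - z) t‖ = |P μ ν z| := fun z => by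
    simp_rw [norm_mul, norm_mFourier_apply, mul_one, Complex.norm_real, Real.norm_eq_abs]; simp
  rw [← integral_tsum_of_summable_integral_norm hint (by simpa only [hnorm] using hS μ ν)]
  simp_rw [integral_const_mul, Torus.integral_mFourier]
  rw [tsum_eq_single (x - y)]
  · simp
  · intro z hz
    rw [if_neg (fun h => hz (sub_eq_zero.mp h).symm), mul_zero]

/-! ## §3 THE CERTIFICATE: a pointwise positive semi-definite symbol gives a positive semi-definite convolution form (`ConvPSD`) -/

/-- [folklore] **BOCHNER, CERTIFICATE DIRECTION.**  If every entry of `P : B12Beta.Kernel d` is absolutely summable and at every point `t` of the dual torus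
`(ℝ∕ℤ)^d` the symbol `P̂(t) = (Σ_z P_{μν}(z) e_{-z}(t))_{μν}` has a quadratic form with nonnegative real part, `0 ≤ Re Σ_{μν} conj(v_μ) P̂_{μν}(t) v_ν` for all
`v ∈ ℂ^d`, then the convolution form of `P` is positive semi-definite on finitely supported real test functions: `ConvPSD P`.  Proof: for `f` supported in `B`,
`Σ_{x,y∈B} Σ_{μν} f_μ(x) P_{μν}(x−y) f_ν(y) = ∫ Σ_{μν} conj(F_μ(t)) P̂_{μν}(t) F_ν(t) dt` with `F_ν(t) = Σ_{y∈B} f_ν(y) e_{-y}(t)` (orthogonality), and the integrand has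
nonnegative real part. -/
theorem convPSD_of_symbol_re_nonneg {P : B12Beta.Kernel d} (hS : ∀ μ ν, Summable fun z => |P μ ν z|)
    (hpsd : ∀ (t : UnitAddTorus (Fin d)) (v : Fin d → ℂ), 0 ≤ (∑ μ, ∑ ν, conj (v μ) * (∑' z, (P μ ν z : ℂ) * mFourier (-z) t) * v ν).re) :
    ConvPSD P := by
  intro B f
  set S : Fin d → Fin d → UnitAddTorus (Fin d) → ℂ := fun μ ν t => ∑' z, (P μ ν z : ℂ) * mFourier (-z) t with hSdef
  set v : UnitAddTorus (Fin d) → Fin d → ℂ := fun t μ => ∑ x ∈ B, (f x μ : ℂ) * mFourier (-x) t with hvdef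
  set g : UnitAddTorus (Fin d) → ℂ := fun t => ∑ μ, ∑ ν, conj (v t μ) * S μ ν t * v t ν with hgdef
  have hSc : ∀ μ ν, Continuous (S μ ν) := fun μ ν => continuous_tsum_mul_mFourier hS μ ν fun z => -z
  have hvc : ∀ μ, Continuous fun t => v t μ := fun μ => continuous_finsetSum _ fun x _ => continuous_const.mul (mFourier (-x)).continuous
  have hgc : Continuous g :=
    continuous_finsetSum _ fun μ _ => continuous_finsetSum _ fun ν _ => ((continuous_conj.comp (hvc μ)).mul (hSc μ ν)).mul (hvc ν)
  have hgi : Integrable g := hgc.integrable_unitAddTorus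
  -- the integrand, expanded
  have hconj : ∀ t μ, conj (v t μ) = ∑ x ∈ B, (f x μ : ℂ) * mFourier x t := fun t μ => by
    rw [hvdef, map_sum]; exact Finset.sum_congr rfl fun x _ => by rw [map_mul, Complex.conj_ofReal, conj_mFourier_neg]
  have hg : ∀ t, g t = ∑ μ, ∑ ν, ∑ x ∈ B, ∑ y ∈ B, ((f x μ * f y ν : ℝ) : ℂ) * (mFourier x t * mFourier (-y) t * S μ ν t) := by
    intro t
    refine Finset.sum_congr rfl fun μ _ => Finset.sum_congr rfl fun ν _ => ?_
    rw [hconj, Finset.sum_mul, Finset.sum_mul]; refine Finset.sum_congr rfl fun x _ => ?_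
    rw [hvdef, Finset.mul_sum]; refine Finset.sum_congr rfl fun y _ => ?_
    push_cast; ring
  -- its integral is the real convolution form
  have hI : ∀ μ ν, ∀ x ∈ B, ∀ y ∈ B, Integrable fun t => ((f x μ * f y ν : ℝ) : ℂ) * (mFourier x t * mFourier (-y) t * S μ ν t) :=
    fun μ ν x _ y _ => (continuous_const.mul ((((mFourier x).continuous).mul (mFourier (-y)).continuous).mul (hSc μ ν))).integrable_unitAddTorus
  have hint : ∫ t, g t = ((∑ x ∈ B, ∑ y ∈ B, ∑ μ, ∑ ν, f x μ * P μ ν (x - y) * f y ν : ℝ) : ℂ) := by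
    simp_rw [hg]
    rw [integral_finsetSum _ fun μ _ => integrable_finsetSum _ fun ν _ => integrable_finsetSum _ fun x hx => integrable_finsetSum _ fun y hy => hI μ ν x hx y hy]
    have e1 : ∀ μ, ∫ t, ∑ ν, ∑ x ∈ B, ∑ y ∈ B, ((f x μ * f y ν : ℝ) : ℂ) * (mFourier x t * mFourier (-y) t * S μ ν t)
        = ∑ ν, ∑ x ∈ B, ∑ y ∈ B, ((f x μ * f y ν : ℝ) : ℂ) * (P μ ν (x - y) : ℂ) := by
      intro μ
      rw [integral_finsetSum _ fun ν _ => integrable_finsetSum _ fun x hx => integrable_finsetSum _ fun y hy => hI μ ν x hx y hy]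
      refine Finset.sum_congr rfl fun ν _ => ?_
      rw [integral_finsetSum _ fun x hx => integrable_finsetSum _ fun y hy => hI μ ν x hx y hy]
      refine Finset.sum_congr rfl fun x hx => ?_
      rw [integral_finsetSum _ fun y hy => hI μ ν x hx y hy]
      refine Finset.sum_congr rfl fun y _ => ?_
      rw [integral_const_mul, integral_mFourier_mul_symbol hS]
    simp_rw [e1]
    push_cast
    calc ∑ μ, ∑ ν, ∑ x ∈ B, ∑ y ∈ B, (f x μ : ℂ) * (f y ν : ℂ) * (P μ ν (x - y) : ℂ)
        = ∑ μ, ∑ x ∈ B, ∑ ν, ∑ y ∈ B, (f x μ : ℂ) * (f y ν : ℂ) * (P μ ν (x - y) : ℂ) := Finset.sum_congr rfl fun μ _ => Finset.sum_comm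
      _ = ∑ x ∈ B, ∑ μ, ∑ ν, ∑ y ∈ B, (f x μ : ℂ) * (f y ν : ℂ) * (P μ ν (x - y) : ℂ) := Finset.sum_comm
      _ = ∑ x ∈ B, ∑ μ, ∑ y ∈ B, ∑ ν, (f x μ : ℂ) * (f y ν : ℂ) * (P μ ν (x - y) : ℂ) :=
          Finset.sum_congr rfl fun x _ => Finset.sum_congr rfl fun μ _ => Finset.sum_comm
      _ = ∑ x ∈ B, ∑ y ∈ B, ∑ μ, ∑ ν, (f x μ : ℂ) * (f y ν : ℂ) * (P μ ν (x - y) : ℂ) := Finset.sum_congr rfl fun x _ => Finset.sum_comm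
      _ = ∑ x ∈ B, ∑ y ∈ B, ∑ μ, ∑ ν, (f x μ : ℂ) * (P μ ν (x - y) : ℂ) * (f y ν : ℂ) :=
          Finset.sum_congr rfl fun x _ => Finset.sum_congr rfl fun y _ => Finset.sum_congr rfl fun μ _ => Finset.sum_congr rfl fun ν _ => by ring
  -- conclude: the real part of the integral is the integral of the (nonnegative) real part
  have hre : (∫ t, g t).re = ∫ t, (g t).re := by simpa only [RCLike.re_to_complex] using (integral_re hgi).symm
  have h0 : 0 ≤ ∫ t, (g t).re := integral_nonneg fun t => hpsd t (v t)
  rwa [← hre, hint, Complex.ofReal_re] at h0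

/-! ## §4 The converse (Bochner's easy direction, matrix-valued): `ConvPSD` ⟹ the symbol's quadratic form has nonnegative real part everywhere -/

open Literature.MathematicalPhysics.QuantumFieldTheory.Balaban1983to89.Beta.PolarizationSign (overlap box sum_sum_sub_eq_tsum tendsto_overlap_div_card
  card_box_pos overlap_le_card overlap_nonneg)

/-- [folklore] The `ConvPSD` forms of the real and imaginary parts of a complex vector test function `a` add up to `Re Σ_{x,y} Σ_{μν} a_μ(x) conj(a_ν(y)) P_{μν}(x − y)`. -/
theorem convForm_re_add_convForm_im (P : B12Beta.Kernel d) (B : Finset (Fin d → ℤ)) (a : (Fin d → ℤ) → Fin d → ℂ) :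
    ∑ x ∈ B, ∑ y ∈ B, ∑ μ, ∑ ν, (a x μ).re * P μ ν (x - y) * (a y ν).re + ∑ x ∈ B, ∑ y ∈ B, ∑ μ, ∑ ν, (a x μ).im * P μ ν (x - y) * (a y ν).im
      = ∑ x ∈ B, ∑ y ∈ B, (∑ μ, ∑ ν, a x μ * conj (a y ν) * (P μ ν (x - y) : ℂ)).re := by
  rw [← Finset.sum_add_distrib]; refine Finset.sum_congr rfl fun x _ => ?_
  rw [← Finset.sum_add_distrib]; refine Finset.sum_congr rfl fun y _ => ?_
  rw [Complex.re_sum, ← Finset.sum_add_distrib]; refine Finset.sum_congr rfl fun μ _ => ?_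
  rw [Complex.re_sum, ← Finset.sum_add_distrib]; refine Finset.sum_congr rfl fun ν _ => ?_
  simp only [Complex.mul_re, Complex.mul_im, Complex.conj_re, Complex.conj_im, Complex.ofReal_re, Complex.ofReal_im]
  ring

/-- [folklore] **BOCHNER, NECESSITY DIRECTION** (vector-valued form of the β sub-cell's `PolarizationSign.bochner_diag_cos`): if the convolution form of an absolutely summable
kernel is positive semi-definite on finitely supported real test functions, then at every point of the dual torus the symbol's quadratic form has nonnegative real part,
`0 ≤ Re Σ_{μν} conj(v_μ) P̂_{μν}(t) v_ν` (test functions `Re`, `Im` of `conj(v_μ) e_{-x}(t)` on the cubes `B_R`; Følner ratio `N_{B_R}(z)/#B_R → 1`; dominated convergence). -/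
theorem symbol_re_nonneg_of_convPSD {P : B12Beta.Kernel d} (hPSD : ConvPSD P) (hS : ∀ μ ν, Summable fun z => |P μ ν z|) (t : UnitAddTorus (Fin d))
    (v : Fin d → ℂ) : 0 ≤ (∑ μ, ∑ ν, conj (v μ) * (∑' z, (P μ ν z : ℂ) * mFourier (-z) t) * v ν).re := by
  classical
  -- the lattice function whose sum is the target
  set F : Fin d → Fin d → (Fin d → ℤ) → ℂ := fun μ ν z => conj (v μ) * ((P μ ν z : ℂ) * mFourier (-z) t) * v ν with hFdef
  set G : (Fin d → ℤ) → ℝ := fun z => (∑ μ, ∑ ν, F μ ν z).re with hGdef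
  have hFnorm : ∀ μ ν z, ‖F μ ν z‖ = ‖v μ‖ * ‖v ν‖ * |P μ ν z| := fun μ ν z => by
    rw [hFdef]; dsimp only; rw [norm_mul, norm_mul, norm_mul, norm_mFourier_apply, mul_one, Complex.norm_real, Real.norm_eq_abs, Complex.norm_conj]; ring
  have hFsum : ∀ μ ν, Summable (F μ ν) := fun μ ν =>
    Summable.of_norm_bounded (((hS μ ν).mul_left (‖v μ‖ * ‖v ν‖))) fun z => (hFnorm μ ν z).le
  -- Step 0: the target is `Σ_z G(z)`
  have htarget : (∑ μ, ∑ ν, conj (v μ) * (∑' z, (P μ ν z : ℂ) * mFourier (-z) t) * v ν).re = ∑' z, G z := by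
    have e1 : ∑ μ, ∑ ν, conj (v μ) * (∑' z, (P μ ν z : ℂ) * mFourier (-z) t) * v ν = ∑' z, ∑ μ, ∑ ν, F μ ν z := by
      rw [Summable.tsum_finsetSum fun μ _ => summable_sum fun ν _ => hFsum μ ν]
      refine Finset.sum_congr rfl fun μ _ => ?_
      rw [Summable.tsum_finsetSum fun ν _ => hFsum μ ν]
      refine Finset.sum_congr rfl fun ν _ => ?_
      rw [← tsum_mul_left, ← tsum_mul_right]
    rw [e1, hGdef]
    exact (Complex.reCLM.map_tsum (summable_sum fun μ _ => summable_sum fun ν _ => hFsum μ ν))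
  -- Step 1: positivity on boxes, `0 ≤ Σ_{x,y∈B} G(x − y)`
  have hbox : ∀ B : Finset (Fin d → ℤ), 0 ≤ ∑ x ∈ B, ∑ y ∈ B, G (x - y) := by
    intro B
    set a : (Fin d → ℤ) → Fin d → ℂ := fun x μ => conj (v μ) * mFourier (-x) t with hadef
    have h := add_nonneg (hPSD B fun x μ => (a x μ).re) (hPSD B fun x μ => (a x μ).im)
    rw [convForm_re_add_convForm_im] at h
    refine h.trans_eq (Finset.sum_congr rfl fun x _ => Finset.sum_congr rfl fun y _ => ?_)
    rw [hGdef]; dsimp only; congr 1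
    refine Finset.sum_congr rfl fun μ _ => Finset.sum_congr rfl fun ν _ => ?_
    rw [hadef, hFdef]; dsimp only
    have e : mFourier (-(x - y)) t = mFourier y t * mFourier (-x) t := by rw [neg_sub, sub_eq_add_neg, mFourier_add]
    rw [map_mul, conj_conj, conj_mFourier_neg, e]
    ring
  -- Step 2: Følner and dominated convergence `R → ∞`
  have hGbound : ∀ z, |G z| ≤ ∑ μ, ∑ ν, ‖v μ‖ * ‖v ν‖ * |P μ ν z| := fun z => by
    rw [hGdef]; dsimp only
    refine (Complex.abs_re_le_norm _).trans ((norm_sum_le _ _).trans (Finset.sum_le_sum fun μ _ => (norm_sum_le _ _).trans (Finset.sum_le_sum fun ν _ => ?_)))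
    rw [hFnorm]
  have hbsum : Summable fun z => ∑ μ, ∑ ν, ‖v μ‖ * ‖v ν‖ * |P μ ν z| :=
    summable_sum fun μ _ => summable_sum fun ν _ => (hS μ ν).mul_left _
  have hlim : Tendsto (fun R : ℕ => ∑' z, G z * (overlap (box d R) z / (box d R).card)) atTop (𝓝 (∑' z, G z * 1)) := by
    refine tendsto_tsum_of_dominated_convergence (bound := fun z => ∑ μ, ∑ ν, ‖v μ‖ * ‖v ν‖ * |P μ ν z|) hbsum (fun z => ?_) ?_
    · exact tendsto_const_nhds.mul (tendsto_overlap_div_card z)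
    · refine Eventually.of_forall fun R z => ?_
      have hq : 0 ≤ overlap (box d R) z / (box d R).card := div_nonneg (overlap_nonneg _ _) (Nat.cast_nonneg _)
      rw [Real.norm_eq_abs, abs_mul, abs_of_nonneg hq]
      calc |G z| * (overlap (box d R) z / (box d R).card) ≤ (∑ μ, ∑ ν, ‖v μ‖ * ‖v ν‖ * |P μ ν z|) * 1 :=
            mul_le_mul (hGbound z) ((div_le_one (card_box_pos R)).mpr (overlap_le_card _ _)) hq ((abs_nonneg _).trans (hGbound z))
        _ = _ := mul_one _
  simp only [mul_one] at hlim
  rw [htarget]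
  refine ge_of_tendsto hlim (Eventually.of_forall fun R => ?_)
  have e : ∑' z, G z * (overlap (box d R) z / (box d R).card) = (∑ x ∈ box d R, ∑ y ∈ box d R, G (x - y)) / (box d R).card := by
    rw [sum_sum_sub_eq_tsum, ← tsum_div_const]
    exact tsum_congr fun z => by ring
  rw [e]
  exact div_nonneg (hbox _) (Nat.cast_nonneg _)

/-- [folklore] **BOCHNER FOR MATRIX KERNELS ON `ℤ^d`, BOTH DIRECTIONS**: for an absolutely summable `P : B12Beta.Kernel d`, the convolution form is positive semi-definite on finitely
supported real test functions (`ConvPSD P`) iff the symbol's quadratic form has nonnegative real part at every point of the dual torus. -/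
theorem convPSD_iff_symbol_re_nonneg {P : B12Beta.Kernel d} (hS : ∀ μ ν, Summable fun z => |P μ ν z|) :
    ConvPSD P ↔ ∀ (t : UnitAddTorus (Fin d)) (v : Fin d → ℂ), 0 ≤ (∑ μ, ∑ ν, conj (v μ) * (∑' z, (P μ ν z : ℂ) * mFourier (-z) t) * v ν).re :=
  ⟨fun h => symbol_re_nonneg_of_convPSD h hS, convPSD_of_symbol_re_nonneg hS⟩


/-! ## §5 Reading the certificate: the flip `z ↦ −z` of the difference variable, and the symbol in real coordinates `k ∈ [0,1)^d` -/

open Literature.MathematicalPhysics.QuantumFieldTheory.Balaban1983to89.Beta.OneStepKernelFamily (flipK flipK_apply)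

/-- [folklore] `e_n(−t) = e_{−n}(t)`. -/
theorem mFourier_apply_neg (n : Fin d → ℤ) (t : UnitAddTorus (Fin d)) : mFourier n (-t) = mFourier (-n) t := by
  simp only [mFourier, ContinuousMap.coe_mk, Pi.neg_apply, fourier_apply, smul_neg, neg_smul]

/-- [folklore] The symbol of the flipped kernel `flipK T` (`z ↦ T(−z)`, the printed difference variable of [Balaban1987RG1] (5.8) vs the `hessKer` convention — see
`OneStepKernelFamily.flipK`) at `t` is the symbol of `T` at `−t`. -/
theorem symbol_flipK (T : B12Beta.Kernel d) (μ ν : Fin d) (t : UnitAddTorus (Fin d)) :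
    ∑' z, (flipK T μ ν z : ℂ) * mFourier (-z) t = ∑' z, (T μ ν z : ℂ) * mFourier (-z) (-t) := by
  rw [← (Equiv.neg (Fin d → ℤ)).tsum_eq (fun z => (T μ ν z : ℂ) * mFourier (-z) (-t))]
  refine tsum_congr fun z => ?_
  simp only [flipK_apply, Equiv.neg_apply, neg_neg, mFourier_apply_neg]

/-- [folklore] Hence the symbol certificate is BLIND TO THE FLIP: it holds for `flipK T` iff it holds for `T` (substitute `t ↦ −t`). -/
theorem symbol_re_nonneg_flipK_iff (T : B12Beta.Kernel d) :
    (∀ (t : UnitAddTorus (Fin d)) (v : Fin d → ℂ), 0 ≤ (∑ μ, ∑ ν, conj (v μ) * (∑' z, (flipK T μ ν z : ℂ) * mFourier (-z) t) * v ν).re)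
      ↔ ∀ (t : UnitAddTorus (Fin d)) (v : Fin d → ℂ), 0 ≤ (∑ μ, ∑ ν, conj (v μ) * (∑' z, (T μ ν z : ℂ) * mFourier (-z) t) * v ν).re := by
  simp_rw [symbol_flipK]
  exact ⟨fun h t v => by simpa only [neg_neg] using h (-t) v, fun h t v => h (-t) v⟩

/-- [folklore] Absolute summability is blind to the flip. -/
theorem summable_abs_flipK_iff (T : B12Beta.Kernel d) (μ ν : Fin d) : (Summable fun z => |flipK T μ ν z|) ↔ Summable fun z => |T μ ν z| := by
  rw [← (Equiv.neg (Fin d → ℤ)).summable_iff]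
  exact Iff.of_eq (congrArg Summable (funext fun z => by simp only [Function.comp_apply, Equiv.neg_apply, flipK_apply, neg_neg]))

/-- [folklore] **`ConvPSD` IS BLIND TO THE FLIP** for absolutely summable kernels (through the symbol; NOT a formal triviality for a non-symmetric kernel: the form of `flipK T` is the
form of the index-transpose of `T`). -/
theorem convPSD_flipK_iff (T : B12Beta.Kernel d) (hS : ∀ μ ν, Summable fun z => |T μ ν z|) : ConvPSD (flipK T) ↔ ConvPSD T := by
  rw [convPSD_iff_symbol_re_nonneg hS, convPSD_iff_symbol_re_nonneg fun μ ν => (summable_abs_flipK_iff T μ ν).mpr (hS μ ν), symbol_re_nonneg_flipK_iff]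

/-- [folklore] THE SYMBOL IN REAL COORDINATES: at the point `k mod ℤ^d` of the dual torus, `e_{−z}(k) = exp(−2πi k·z)`. -/
theorem mFourier_neg_coe_apply (z : Fin d → ℤ) (k : Fin d → ℝ) :
    mFourier (-z) (fun i => ((k i : ℝ) : UnitAddCircle)) = cexp (-(2 * π * I) * ∑ i, (k i : ℂ) * (z i : ℂ)) := by
  simp only [mFourier, ContinuousMap.coe_mk, Pi.neg_apply, fourier_coe_apply, Complex.ofReal_one, div_one, Int.cast_neg]
  rw [← Complex.exp_sum, Finset.mul_sum]
  congr 1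
  exact Finset.sum_congr rfl fun i _ => by ring

/-- [folklore] Every point of the dual torus is `k mod ℤ^d` for some `k ∈ [0,1)^d`. -/
theorem exists_Ico_coe_eq (t : UnitAddTorus (Fin d)) : ∃ k : Fin d → ℝ, (∀ i, k i ∈ Set.Ico (0 : ℝ) 1) ∧ (fun i => ((k i : ℝ) : UnitAddCircle)) = t := by
  refine ⟨fun i => ((AddCircle.equivIco (1 : ℝ) 0) (t i) : ℝ), fun i => ?_, funext fun i => ?_⟩
  · simpa only [zero_add] using ((AddCircle.equivIco (1 : ℝ) 0) (t i)).2
  · exact (AddCircle.equivIco (1 : ℝ) 0).symm_apply_apply (t i)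

/-- [folklore] **THE CERTIFICATE IN REAL COORDINATES** (the statement an interval computation checks): if every entry of `P` is absolutely summable and for every `k ∈ [0,1)^d` and every
`v ∈ ℂ^d`, `0 ≤ Re Σ_{μν} conj(v_μ) (Σ_z P_{μν}(z) e^{−2πi k·z}) v_ν`, then `ConvPSD P`. -/
theorem convPSD_of_symbol_re_nonneg_Ico {P : B12Beta.Kernel d} (hS : ∀ μ ν, Summable fun z => |P μ ν z|)
    (hpsd : ∀ k : Fin d → ℝ, (∀ i, k i ∈ Set.Ico (0 : ℝ) 1) → ∀ v : Fin d → ℂ,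
      0 ≤ (∑ μ, ∑ ν, conj (v μ) * (∑' z, (P μ ν z : ℂ) * cexp (-(2 * π * I) * ∑ i, (k i : ℂ) * (z i : ℂ))) * v ν).re) :
    ConvPSD P := by
  refine convPSD_of_symbol_re_nonneg hS fun t v => ?_
  obtain ⟨k, hk, rfl⟩ := exists_Ico_coe_eq t
  simpa only [mFourier_neg_coe_apply] using hpsd k hk v

/-- [folklore] The same for a kernel given in the `hessKer` difference variable: a real-coordinate symbol certificate for `T` gives `ConvPSD (flipK T)` (the form in which the β
sub-cell's Lemma 5.2 lemmas and this seat's rows 86 ∕ 87 ∕ 92 consume PSD). -/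
theorem convPSD_flipK_of_symbol_re_nonneg_Ico {T : B12Beta.Kernel d} (hS : ∀ μ ν, Summable fun z => |T μ ν z|)
    (hpsd : ∀ k : Fin d → ℝ, (∀ i, k i ∈ Set.Ico (0 : ℝ) 1) → ∀ v : Fin d → ℂ,
      0 ≤ (∑ μ, ∑ ν, conj (v μ) * (∑' z, (T μ ν z : ℂ) * cexp (-(2 * π * I) * ∑ i, (k i : ℂ) * (z i : ℂ))) * v ν).re) :
    ConvPSD (flipK T) :=
  (convPSD_flipK_iff T hS).mpr (convPSD_of_symbol_re_nonneg_Ico hS hpsd)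


/-! ## §6 The certificate at the row-(D1) literals: a symbol-PSD certificate for the level-`j` one-step kernel (+ `hW_j` off an2's chart-(II) literal) ⟹ `0 ≤ β⁰_j(μ,ν)` -/

section Literals

open Literature.MathematicalPhysics.QuantumFieldTheory.Balaban1983to89.Beta
open OneStepResolventKernel (JetData)
open OneStepKernelFamily (TbalOf)
open Literature.MathematicalPhysics.QuantumFieldTheory.Balaban1983to89.Beta.PolarizationSign (WardTransversal IndexSymmetric MomentSummable)
open Summit.QuantumFields.BalabanUV.Beta.MixedJetTablesPlug (JsBalAn1)
open Summit.QuantumFields.BalabanUV.Beta.CombChartJointEnd (JsB12CombShSym)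
open Summit.QuantumFields.BalabanUV.Beta.SymmetrisedStepJets (SymTables)
open Summit.QuantumFields.BalabanUV.Beta.RowD1JointEnd (JsRowD1Pin)
open Summit.QuantumFields.BalabanUV.Gaps.D1IndexSymmetryDictionary (momentSummable_TbalOf)
open Summit.QuantumFields.BalabanUV.Gaps.D1WardLongitudinalForm (secondMoment_nonneg_of_ward_indexSymmetric_convPSD secondMoment_TbalOf_JsBalAn1_nonneg_of_hW_convPSD
  secondMoment_TbalOf_JsB12CombShSym_nonneg_of_hW_convPSD)
open Summit.QuantumFields.BalabanUV.Gaps.D1CoDressedLongitudinalForm (secondMoment_TbalOf_JsRowD1Pin_nonneg_of_convPSD)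
open Summit.QuantumFields.BalabanUV.Gaps.D1WardPSDSandwich (secondMoment_TbalOf_JsBalAn1_le_trace_of_hW_convPSD secondMoment_TbalOf_JsB12CombShSym_le_trace_of_hW_convPSD)

/-- [folklore] **LEMMA 5.2 WITH THE CERTIFICATE, GENERIC KERNEL**: summable third moments, the Ward identity (5.9), the index symmetry (5.8) and a pointwise symbol certificate on the
dual torus give `0 ≤ β_{αβ} = Σ_x P_{αβ}(x) x_α x_β` (`α ≠ β`) — row 86's hR-free Lemma 5.2 with its `ConvPSD` input DISCHARGED by §3. -/
theorem secondMoment_nonneg_of_ward_indexSymmetric_symbol {P : B12Beta.Kernel d} (hP : MomentSummable P 3) (hT : WardTransversal P) (hS : IndexSymmetric P)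
    (hpsd : ∀ (t : UnitAddTorus (Fin d)) (v : Fin d → ℂ), 0 ≤ (∑ μ, ∑ ν, conj (v μ) * (∑' z, (P μ ν z : ℂ) * mFourier (-z) t) * v ν).re) {α β : Fin d} (hαβ : α ≠ β) :
    0 ≤ B12Beta.secondMoment P α β :=
  secondMoment_nonneg_of_ward_indexSymmetric_convPSD hP hT hS (convPSD_of_symbol_re_nonneg (fun μ ν => hP.summable_abs μ ν) hpsd) hαβ

variable {Lc : ℕ} [NeZero Lc]

/-- [folklore] Every one-step kernel `T_j = TbalOf Lc Js j` over step jet data has absolutely summable entries (GEN 14's `momentSummable_TbalOf`, order `0`). -/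
theorem summable_abs_TbalOf (Js : ℕ → JetData 3 Lc) (j : ℕ) (μ ν : Fin 4) : Summable fun z => |TbalOf Lc Js j μ ν z| :=
  (momentSummable_TbalOf Js j 0).summable_abs μ ν

/-- [folklore] **THE KERNEL-SIDE SOCKET FOR A CERTIFIED SYMBOL COMPUTATION** (every one-step family `Js`, every level `j`): if for every `k ∈ [0,1)^4` and every `v ∈ ℂ^4`
`0 ≤ Re Σ_{μν} conj(v_μ) (Σ_z T_j(μ,ν,z) e^{−2πi k·z}) v_ν` — the symbol of the UNFLIPPED table `T_j` as deposited — then `ConvPSD (flipK T_j)`, the PSD hypothesis of the β sub-cell's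
Lemma 5.2 and of rows 86 ∕ 87 ∕ 92 ∕ 93.  No symmetry of `T_j` is used. -/
theorem convPSD_flipK_TbalOf_of_symbol_re_nonneg_Ico (Js : ℕ → JetData 3 Lc) (j : ℕ)
    (hpsd : ∀ k : Fin 4 → ℝ, (∀ i, k i ∈ Set.Ico (0 : ℝ) 1) → ∀ v : Fin 4 → ℂ,
      0 ≤ (∑ μ, ∑ ν, conj (v μ) * (∑' z, (TbalOf Lc Js j μ ν z : ℂ) * cexp (-(2 * π * I) * ∑ i, (k i : ℂ) * (z i : ℂ))) * v ν).re) :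
    ConvPSD (flipK (TbalOf Lc Js j)) :=
  convPSD_flipK_of_symbol_re_nonneg_Ico (summable_abs_TbalOf Js j) hpsd

/-- [folklore] **… AND ITS NECESSITY** (the by-value screens are honest tests): if `ConvPSD (flipK T_j)` holds then at EVERY real momentum `k` and every `v ∈ ℂ^4` the symbol form of
`T_j` has nonnegative real part — a certified NEGATIVE transverse eigenvalue of `T̂_j(k)` at one `k` REFUTES the PSD hypothesis for that level. -/
theorem symbol_re_nonneg_of_convPSD_flipK_TbalOf (Js : ℕ → JetData 3 Lc) (j : ℕ) (hPSD : ConvPSD (flipK (TbalOf Lc Js j))) (k : Fin 4 → ℝ) (v : Fin 4 → ℂ) :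
    0 ≤ (∑ μ, ∑ ν, conj (v μ) * (∑' z, (TbalOf Lc Js j μ ν z : ℂ) * cexp (-(2 * π * I) * ∑ i, (k i : ℂ) * (z i : ℂ))) * v ν).re := by
  have h := symbol_re_nonneg_of_convPSD ((convPSD_flipK_iff _ (summable_abs_TbalOf Js j)).mp hPSD) (summable_abs_TbalOf Js j) (fun i => ((k i : ℝ) : UnitAddCircle)) v
  simpa only [mFourier_neg_coe_apply] using h

/-- [folklore] **AN2's CHART-(II) CO-DRESSED LITERAL `JsRowD1Pin hLc N` (`Odd Lc`, `2 ≤ N`): A SYMBOL CERTIFICATE AT LEVEL `j` ALONE GIVES `0 ≤ β⁰_j(μ,ν)`** (`μ ≠ ν`) — row 87's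
`secondMoment_TbalOf_JsRowD1Pin_nonneg_of_convPSD` (hW ∧ hR are THEOREMS there) with its only hypothesis `ConvPSD` replaced by the real-coordinate certificate. -/
theorem secondMoment_TbalOf_JsRowD1Pin_nonneg_of_symbol (hLc : Odd Lc) {N : ℕ} (hN : 2 ≤ N) (j : ℕ)
    (hpsd : ∀ k : Fin 4 → ℝ, (∀ i, k i ∈ Set.Ico (0 : ℝ) 1) → ∀ v : Fin 4 → ℂ,
      0 ≤ (∑ μ, ∑ ν, conj (v μ) * (∑' z, (TbalOf Lc (JsRowD1Pin hLc N) j μ ν z : ℂ) * cexp (-(2 * π * I) * ∑ i, (k i : ℂ) * (z i : ℂ))) * v ν).re)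
    {μ ν : Fin 4} (hμν : μ ≠ ν) : 0 ≤ B12Beta.secondMoment (TbalOf Lc (JsRowD1Pin hLc N) j) μ ν :=
  secondMoment_TbalOf_JsRowD1Pin_nonneg_of_convPSD hLc hN j (convPSD_flipK_TbalOf_of_symbol_re_nonneg_Ico _ j hpsd) hμν

variable {r : Fin (3 + 1) → ℕ}

/-- [folklore] **THE β-LEAD's PINNED FAMILY `JsBalAn1 …` (any `1 ≤ Lc`, root, colours, `cE₂`, `cB`, `T`): `hW_j` + A SYMBOL CERTIFICATE AT LEVEL `j` ⟹ row 92's SANDWICH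
`0 ≤ β⁰_j(μ,ν) ≤ −¼ Σ_ν Σ_z T_j(ν,ν,z)|z|²`** (`μ ≠ ν`) — rows 86 ∕ 92 with `ConvPSD` replaced by the certificate; the Ward binder `hW_j` REMAINS a hypothesis. -/
theorem secondMoment_TbalOf_JsBalAn1_sandwich_of_hW_symbol (hLc : 1 ≤ Lc) (hr : r ∈ AffineAveraging.box (3 + 1) Lc) (cE cVH cΛ cE₂ cB : ℝ) (T : Fin 4 → Fin 4 → Fin 4 → Fin 4 → ℝ) (j : ℕ)
    (hW : WardTransversal (flipK (TbalOf Lc (JsBalAn1 hLc hr cE cVH cΛ cE₂ cB T) j)))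
    (hpsd : ∀ k : Fin 4 → ℝ, (∀ i, k i ∈ Set.Ico (0 : ℝ) 1) → ∀ v : Fin 4 → ℂ,
      0 ≤ (∑ μ, ∑ ν, conj (v μ) * (∑' z, (TbalOf Lc (JsBalAn1 hLc hr cE cVH cΛ cE₂ cB T) j μ ν z : ℂ) * cexp (-(2 * π * I) * ∑ i, (k i : ℂ) * (z i : ℂ))) * v ν).re)
    {μ ν : Fin 4} (hμν : μ ≠ ν) :
    0 ≤ B12Beta.secondMoment (TbalOf Lc (JsBalAn1 hLc hr cE cVH cΛ cE₂ cB T) j) μ ν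
      ∧ B12Beta.secondMoment (TbalOf Lc (JsBalAn1 hLc hr cE cVH cΛ cE₂ cB T) j) μ ν ≤ -(1 / 4) * ∑ ν, ∑' z, TbalOf Lc (JsBalAn1 hLc hr cE cVH cΛ cE₂ cB T) j ν ν z * ∑ μ, (z μ : ℝ) ^ 2 :=
  have hPSD := convPSD_flipK_TbalOf_of_symbol_re_nonneg_Ico _ j hpsd
  ⟨secondMoment_TbalOf_JsBalAn1_nonneg_of_hW_convPSD hLc hr cE cVH cΛ cE₂ cB T j hW hPSD hμν, secondMoment_TbalOf_JsBalAn1_le_trace_of_hW_convPSD hLc hr cE cVH cΛ cE₂ cB T j hW hPSD hμν⟩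

/-- [folklore] **THE b2b WALL's (III′) LITERAL `JsB12CombShSym hLc N tabs cΛ cB` (every table record; `Odd Lc`): `hW_j` + A SYMBOL CERTIFICATE AT LEVEL `j` ⟹ `0 ≤ β⁰_j(μ,ν) ≤ −¼ Σ tr T_j|z|²`.** -/
theorem secondMoment_TbalOf_JsB12CombShSym_sandwich_of_hW_symbol (hLc : Odd Lc) (N : ℕ) (tabs : SymTables 3 Lc) (cΛ cB : ℝ) (j : ℕ)
    (hW : WardTransversal (flipK (TbalOf Lc (JsB12CombShSym hLc N tabs cΛ cB) j)))
    (hpsd : ∀ k : Fin 4 → ℝ, (∀ i, k i ∈ Set.Ico (0 : ℝ) 1) → ∀ v : Fin 4 → ℂ,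
      0 ≤ (∑ μ, ∑ ν, conj (v μ) * (∑' z, (TbalOf Lc (JsB12CombShSym hLc N tabs cΛ cB) j μ ν z : ℂ) * cexp (-(2 * π * I) * ∑ i, (k i : ℂ) * (z i : ℂ))) * v ν).re)
    {μ ν : Fin 4} (hμν : μ ≠ ν) :
    0 ≤ B12Beta.secondMoment (TbalOf Lc (JsB12CombShSym hLc N tabs cΛ cB) j) μ ν
      ∧ B12Beta.secondMoment (TbalOf Lc (JsB12CombShSym hLc N tabs cΛ cB) j) μ ν ≤ -(1 / 4) * ∑ ν, ∑' z, TbalOf Lc (JsB12CombShSym hLc N tabs cΛ cB) j ν ν z * ∑ μ, (z μ : ℝ) ^ 2 :=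
  have hPSD := convPSD_flipK_TbalOf_of_symbol_re_nonneg_Ico _ j hpsd
  ⟨secondMoment_TbalOf_JsB12CombShSym_nonneg_of_hW_convPSD hLc N tabs cΛ cB j hW hPSD hμν, secondMoment_TbalOf_JsB12CombShSym_le_trace_of_hW_convPSD hLc N tabs cΛ cB j hW hPSD hμν⟩

end Literals

end Summit.QuantumFields.BalabanUV.Gaps.D1SymbolPSDCertificate
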